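import Summits.QuantumFields.BalabanUV.Beta.GAN24.BiStencilZeroMode

/-!
# `BalabanUV.Beta.GAN24.JointPeriodicCellSwap` — binder row G-an2-4 ∕ (CONV-C), conservation law (C) AT LEVELS `j ≥ 1`, the (γ) hand's «DEPTH TOWER»
# (memo `HOME/b2b-balaban-gan24-formalise-leaf-06/g54/C-LEVELS-GE1-g54.md` §29, letter K4a): **THE CELL SLOT AND THE FREE SLOT OF A JOINTLY PERIODIC
# TWO-SLOT SUM MAY BE SWAPPED** — for `G (a + P•s) (b + Q•s) = G a b` (one shift `s`, two periods `P`, `Q`),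
# `Σ_{a ∈ box P} Σ'_b G a b = Σ_{b ∈ box Q} Σ'_a G a b` (`sum_box_tsum_swap`).

NOT IN PRINT; OUR BOOKKEEPING ([folklore] two fundamental domains of the diagonal action `s ↦ (a + P•s, b + Q•s)` on `ℤ^{d+1} × ℤ^{d+1}`, over leaf-02's
`BiStencilZeroMode.tsum_eq_sum_box_tsum` (coset decomposition of a lattice sum) BY NAME; G-an2-4 formalisation swarm, leaf prover
`b2b-balaban-gan24-formalise-leaf-06`, gen 54).  HONEST FRAMING (cell contract, verbatim): «discharging `BetaPertH` makes Bałaban's UV stability UNCONDITIONAL — a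
real constructive-QFT result; it is NOT the continuum limit and NOT the Clay problem.»  HONEST DEPENDENCY (verbatim): «continuum YM on T⁴ ⇐ BetaPertH ∧ nine spine
estimates (0/9 proved); BetaPertH ⇐ (D1) ∧ (D4) ∧ CAP+tail; G-an2-4 gates asym, D1 and NE2/3/4.»

WHY (the located use, memo §29 (1) and letter K4): the FOUR-FACE reading of a jointly block-covariant two-bond word (leaf-02 Part 39's `FOURFACE_j` bracket ∕ road-P2's
`T2RecChargeStepFourFace`) restricts the CELL bond `c′ ∈ box Lc` to an exit face and sums the other bond `u′` over the lattice on an exit face.  This lineage's K1a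
(`DressedVertexFaceBondSum.tsum_faceBond_vertexOfK_dressedStep`) deepens a LATTICE face-bond sum of the dressed vertex (`Σ'_{u′} χ^{N}_ν(u′)·dM_{ν,u′} =
(s_f s_m)·cH·Σ'_t χ^{Lc·N}_ν(t)·S_{ν,t}`) but not a cell-restricted one.  The swap puts the lattice sum on whichever bond is to be deepened: once with periods
`(Lc, Lc)` (deepen the cell bond after swapping it free), once with periods `(Lc², Lc)` (swap back: the deepened fine slot has period `Lc²`), so that the
four-face EE word becomes the two-face EE word of the FINE tables with slot class `Lc²` and leg class `Lc` (letter K4).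

MECHANISM: decompose the free slot into cosets (`tsum_eq_sum_box_tsum` at period `Q`), use the joint periodicity to move the coset shift onto the cell slot
(`G a (Q•s + r) = G (a − P•s) r`), re-index `s ↦ −s`, and reassemble the cell slot and the shift into one lattice sum (`tsum_eq_sum_box_tsum` at period `P`,
backwards).  Summability of each slot section is assumed (it is what makes both sides meaningful).

WHAT ([folklore]; 0 `def`, 0 cited facts, 0 `def … : Prop`, 0 sorry): `sum_box_tsum_swap` and the weighted reading `sum_box_tsum_swap_weight` (periodic slot
weights, e.g. exit-face indicators, absorbed into `G`).  Asserts NO value of Bałaban's tables; discharges NOTHING of (C) ∕ (C)sym ∕ (Q-D); NEVER «G-an2-4 closed»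
as (CONV-C); NOT D1, NOT `BetaPertH`, NOT continuum, NOT Clay.  2026-08-24; no existing file touched.
-/

noncomputable section

open Finset
open scoped BigOperators
open Literature.MathematicalPhysics.QuantumFieldTheory
open Literature.MathematicalPhysics.QuantumFieldTheory.Balaban1983to89.Beta
open AffineAveraging (box toSite)
open Summit.QuantumFields.BalabanUV.Beta.GAN24.BiStencilZeroMode (tsum_eq_sum_box_tsum)

namespace Summit.QuantumFields.BalabanUV.Beta.GAN24.JointPeriodicCellSwap

variable {d : ℕ} {P Q : ℕ} [NeZero P] [NeZero Q]

/-- [folklore] **CELL SLOT ↔ FREE SLOT FOR A JOINTLY PERIODIC TWO-SLOT SUM**: if `G (a + P•s) (b + Q•s) = G a b` for all `a b s` and every slot section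
is summable, then `Σ_{a ∈ box P} Σ'_b G a b = Σ_{b ∈ box Q} Σ'_a G a b` (both are the sum of `G` over a fundamental domain of the diagonal shift). -/
theorem sum_box_tsum_swap (G : (Fin (d + 1) → ℤ) → (Fin (d + 1) → ℤ) → ℝ)
    (hG : ∀ a b s, G (a + (P : ℤ) • s) (b + (Q : ℤ) • s) = G a b)
    (hGa : ∀ a, Summable (G a)) (hGb : ∀ b, Summable fun a => G a b) :
    ∑ a ∈ box (d + 1) P, ∑' b, G (toSite a) b = ∑ b ∈ box (d + 1) Q, ∑' a, G a (toSite b) := by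
  -- cosets of the free slot, the shift moved onto the cell slot
  have h1 : ∀ a ∈ box (d + 1) P, (∑' b, G (toSite a) b) =
      ∑ r ∈ box (d + 1) Q, ∑' s : Fin (d + 1) → ℤ, G ((P : ℤ) • (-s) + toSite a) (toSite r) := by
    intro a _
    rw [tsum_eq_sum_box_tsum (N := Q) (hGa (toSite a))]
    refine Finset.sum_congr rfl fun r _ => tsum_congr fun s => ?_
    have e : G (toSite a) ((Q : ℤ) • s + toSite r) = G (((P : ℤ) • (-s) + toSite a) + (P : ℤ) • s) (toSite r + (Q : ℤ) • s) := by
      congr 1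
      · rw [smul_neg, neg_add_cancel_comm]
      · exact add_comm _ _
    rw [e, hG]
  rw [Finset.sum_congr rfl h1, Finset.sum_comm]
  refine Finset.sum_congr rfl fun r _ => ?_
  -- re-index `s ↦ −s` and reassemble the cell slot with the shift
  have h2 : ∀ a ∈ box (d + 1) P, (∑' s : Fin (d + 1) → ℤ, G ((P : ℤ) • (-s) + toSite a) (toSite r)) =
      ∑' s : Fin (d + 1) → ℤ, G ((P : ℤ) • s + toSite a) (toSite r) := by
    intro a _
    exact (Equiv.neg (Fin (d + 1) → ℤ)).tsum_eq (fun s => G ((P : ℤ) • s + toSite a) (toSite r))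
  rw [Finset.sum_congr rfl h2, ← tsum_eq_sum_box_tsum (N := P) (hGb (toSite r))]

/-- [folklore] The same with PERIODIC SLOT WEIGHTS made explicit (`f` `P`-periodic on the first slot, `g` `Q`-periodic on the second — e.g. exit-face indicators):
`Σ_{a ∈ box P} f a·Σ'_b g b·G a b = Σ_{b ∈ box Q} g b·Σ'_a f a·G a b`. -/
theorem sum_box_tsum_swap_weight (G : (Fin (d + 1) → ℤ) → (Fin (d + 1) → ℤ) → ℝ) (f g : (Fin (d + 1) → ℤ) → ℝ)
    (hG : ∀ a b s, G (a + (P : ℤ) • s) (b + (Q : ℤ) • s) = G a b)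
    (hf : ∀ a s, f (a + (P : ℤ) • s) = f a) (hg : ∀ b s, g (b + (Q : ℤ) • s) = g b)
    (hGa : ∀ a, Summable fun b => g b * G a b) (hGb : ∀ b, Summable fun a => f a * G a b) :
    ∑ a ∈ box (d + 1) P, f (toSite a) * ∑' b, g b * G (toSite a) b = ∑ b ∈ box (d + 1) Q, g (toSite b) * ∑' a, f a * G a (toSite b) := by
  have e1 : ∀ a ∈ box (d + 1) P, f (toSite a) * (∑' b, g b * G (toSite a) b) = ∑' b, f (toSite a) * g b * G (toSite a) b := by
    intro a _
    rw [← tsum_mul_left]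
    exact tsum_congr fun b => by ring
  have e2 : ∀ b ∈ box (d + 1) Q, g (toSite b) * (∑' a, f a * G a (toSite b)) = ∑' a, f a * g (toSite b) * G a (toSite b) := by
    intro b _
    rw [← tsum_mul_left]
    exact tsum_congr fun a => by ring
  rw [Finset.sum_congr rfl e1, Finset.sum_congr rfl e2]
  refine sum_box_tsum_swap (P := P) (Q := Q) (fun a b => f a * g b * G a b) ?_ ?_ ?_
  · intro a b s
    show f (a + (P : ℤ) • s) * g (b + (Q : ℤ) • s) * G (a + (P : ℤ) • s) (b + (Q : ℤ) • s) = f a * g b * G a b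
    rw [hf, hg, hG]
  · intro a
    simpa [mul_assoc] using (hGa a).mul_left (f a)
  · intro b
    have h := (hGb b).mul_left (g b)
    refine h.congr fun a => ?_
    ring

end Summit.QuantumFields.BalabanUV.Beta.GAN24.JointPeriodicCellSwap

end
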